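import Summits.NavierStokesRegularity.FunctionalMining.NoGo.LogDoorPacket
import HarnessLib

/-!
# The log-door packet, companion: the linear strain `E = n η(z) (x, −y, 0)` on `ℝ³`

Search for candidate a priori estimates; no regularity claim. NS FUNCTIONAL MINING — NO-GO BRANCH
(cell `pub-nsfunc`, prove seat gen 3). The exactly linear planar strain field of rate `n`, cut off
in `z` by a profile `η`: `strain n η = n η(z) (x, −y, 0) = (∂_y F, −∂_x F, 0)` with `F = n x y η(z)`.
It is the core of the bounded-vorticity background (`NoGo/LogDoorBackground.lean`); here: components
as separable monomials with profiles `(t ↦ t, 1, η)` / `(1, t ↦ t, η)`, smoothness, `fderiv`, `Δ`,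
`Δ²` (`Δ²E = n η⁽⁴⁾(z) (x, −y, 0)`), divergence zero. Folklore calculus; nothing is asserted about
Navier–Stokes.
-/

open MeasureTheory Set Function
open scoped ContDiff Laplacian InnerProductSpace RealInnerProductSpace

namespace Summit.NavierStokesRegularity.FunctionalMining

namespace Sep3

/-- `2 ≤ ∞` in `WithTop ℕ∞`. [folklore] -/
private theorem two_le_infty₃ : (2 : WithTop ℕ∞) ≤ ∞ := by
  change ((2 : ℕ∞) : WithTop ℕ∞) ≤ ((⊤ : ℕ∞) : WithTop ℕ∞)
  exact_mod_cast (le_top : (2 : ℕ∞) ≤ ⊤)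

/-- `∞ ≠ 0` in `WithTop ℕ∞`. [folklore] -/
private theorem infty_ne_zero₃ : (∞ : WithTop ℕ∞) ≠ 0 := by simp

/-! ## The linear strain `E = n η(z) (x, −y, 0)` -/

section Strain

/-- Profiles `(t ↦ t, 1, η)`: `sep (linX η) 0 0 0 (y) = y₀ η(y₂)`. [folklore] -/
def linX (η : ℝ → ℝ) : Fin 3 → ℝ → ℝ := ![fun t => t, fun _ => 1, η]

/-- Profiles `(1, t ↦ t, η)`: `sep (linY η) 0 0 0 (y) = y₁ η(y₂)`. [folklore] -/
def linY (η : ℝ → ℝ) : Fin 3 → ℝ → ℝ := ![fun _ => 1, fun t => t, η]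

/-- The profiles `linX η` are smooth when `η` is. [folklore] -/
theorem contDiff_linX {η : ℝ → ℝ} (hη : ContDiff ℝ ∞ η) : ∀ a, ContDiff ℝ ∞ (linX η a) := by
  intro a
  obtain rfl | rfl | rfl : a = 0 ∨ a = 1 ∨ a = 2 := by fin_cases a <;> simp
  · exact contDiff_id
  · exact contDiff_const
  · exact hη

/-- The profiles `linY η` are smooth when `η` is. [folklore] -/
theorem contDiff_linY {η : ℝ → ℝ} (hη : ContDiff ℝ ∞ η) : ∀ a, ContDiff ℝ ∞ (linY η a) := by
  intro a
  obtain rfl | rfl | rfl : a = 0 ∨ a = 1 ∨ a = 2 := by fin_cases a <;> simp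
  · exact contDiff_const
  · exact contDiff_id
  · exact hη

/-- `(t ↦ t)⁽⁰⁾ = t`. [folklore] -/
theorem iteratedDeriv_id_zero (s : ℝ) : iteratedDeriv 0 (fun t : ℝ => t) s = s := by
  rw [iteratedDeriv_zero]

/-- `(t ↦ t)' = 1`. [folklore] -/
theorem iteratedDeriv_id_one (s : ℝ) : iteratedDeriv 1 (fun t : ℝ => t) s = 1 := by
  rw [iteratedDeriv_one]; exact congrFun deriv_id'' s

/-- `(t ↦ t)⁽ᵏ⁺²⁾ = 0`. [folklore] -/
theorem iteratedDeriv_id_add_two (k : ℕ) (s : ℝ) : iteratedDeriv (k + 2) (fun t : ℝ => t) s = 0 := by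
  rw [show k + 2 = (k + 1) + 1 from rfl, iteratedDeriv_succ', deriv_id'', iteratedDeriv_succ',
    deriv_const']
  simp

/-- Values of the separable monomials of `linX`. [folklore] -/
theorem sep_linX (η : ℝ → ℝ) (i j k : ℕ) (y : E3) :
    sep (linX η) i j k y = iteratedDeriv i (fun t : ℝ => t) (y 0) *
      (if j = 0 then (1 : ℝ) else 0) * iteratedDeriv k η (y 2) := by
  simp only [sep, linX, Matrix.cons_val_zero, Matrix.cons_val_one, Matrix.cons_val_two,
    Matrix.tail_cons, Matrix.head_cons, iteratedDeriv_const]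

/-- Values of the separable monomials of `linY`. [folklore] -/
theorem sep_linY (η : ℝ → ℝ) (i j k : ℕ) (y : E3) :
    sep (linY η) i j k y = (if i = 0 then (1 : ℝ) else 0) *
      iteratedDeriv j (fun t : ℝ => t) (y 1) * iteratedDeriv k η (y 2) := by
  simp only [sep, linY, Matrix.cons_val_zero, Matrix.cons_val_one, Matrix.cons_val_two,
    Matrix.tail_cons, Matrix.head_cons, iteratedDeriv_const]

variable (n : ℝ) (η : ℝ → ℝ)

/-- Scalar components of the strain `n η(z) (x, −y, 0)`. [folklore] -/
noncomputable def UE : Fin 3 → E3 → ℝ :=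
  ![fun y => n * sep (linX η) 0 0 0 y, fun y => -(n * sep (linY η) 0 0 0 y), 0]

/-- The linear strain field `E = n η(z) (x, −y, 0)` on `ℝ³`. [folklore] -/
noncomputable def strain : E3 → E3 := vec3 (UE n η)

/-- Component `0` of the strain. [folklore] -/
@[simp] theorem UE_zero : UE n η 0 = fun y => n * sep (linX η) 0 0 0 y := rfl
/-- Component `1` of the strain. [folklore] -/
@[simp] theorem UE_one : UE n η 1 = fun y => -(n * sep (linY η) 0 0 0 y) := rfl
/-- Component `2` of the strain. [folklore] -/
@[simp] theorem UE_two : UE n η 2 = fun _ => 0 := rfl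

/-- Component `0` of the strain, pointwise, in the atoms `y₀`, `η⁽⁰⁾(y₂)`. [folklore] -/
theorem UE_zero_apply (y : E3) : UE n η 0 y = n * (y 0 * iteratedDeriv 0 η (y 2)) := by
  simp [sep_linX, iteratedDeriv_id_zero]
/-- Component `1` of the strain, pointwise. [folklore] -/
theorem UE_one_apply (y : E3) : UE n η 1 y = -(n * (y 1 * iteratedDeriv 0 η (y 2))) := by
  simp [sep_linY, iteratedDeriv_id_zero]
/-- Component `2` of the strain, pointwise. [folklore] -/
theorem UE_two_apply (y : E3) : UE n η 2 y = 0 := rfl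

/-- The strain in coordinates: `E(y) = (n y₀ η(y₂), −n y₁ η(y₂), 0)`. [folklore] -/
theorem strain_apply (y : E3) :
    strain n η y 0 = n * (y 0 * η (y 2)) ∧ strain n η y 1 = -(n * (y 1 * η (y 2))) ∧
      strain n η y 2 = 0 := by
  refine ⟨?_, ?_, ?_⟩ <;>
    simp [strain, sep_linX, sep_linY, iteratedDeriv_id_zero, iteratedDeriv_zero]

variable {n η}

/-- The strain components are smooth. [folklore] -/
theorem contDiff_UE (hη : ContDiff ℝ ∞ η) (i : Fin 3) : ContDiff ℝ ∞ (UE n η i) := by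
  obtain rfl | rfl | rfl : i = 0 ∨ i = 1 ∨ i = 2 := by fin_cases i <;> simp
  · exact contDiff_const.mul (contDiff_sep (contDiff_linX hη) 0 0 0)
  · exact (contDiff_const.mul (contDiff_sep (contDiff_linY hη) 0 0 0)).neg
  · exact contDiff_const

/-- The strain components are differentiable. [folklore] -/
theorem differentiable_UE (hη : ContDiff ℝ ∞ η) (i : Fin 3) : Differentiable ℝ (UE n η i) :=
  (contDiff_UE hη i).differentiable infty_ne_zero₃

/-- The strain is smooth. [folklore] -/
theorem contDiff_strain (hη : ContDiff ℝ ∞ η) : ContDiff ℝ ∞ (strain n η) :=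
  contDiff_vec3 (contDiff_UE hη)

/-- Components of the strain. [folklore] -/
theorem strain_apply' (y : E3) (i : Fin 3) : strain n η y i = UE n η i y := rfl

/-- Directional derivatives of the strain, componentwise. [folklore] -/
theorem fderiv_strain_apply (hη : ContDiff ℝ ∞ η) (y v : E3) (i : Fin 3) :
    fderiv ℝ (strain n η) y v i = fderiv ℝ (UE n η i) y v :=
  fderiv_vec3_apply (differentiable_UE hη) y v i

/-- `D E₀ (y) v = n (v₀ η(y₂) + v₂ y₀ η'(y₂))`. [folklore] -/
theorem fderiv_UE_zero (hη : ContDiff ℝ ∞ η) (y v : E3) :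
    fderiv ℝ (UE n η 0) y v =
      n * (v 0 * iteratedDeriv 0 η (y 2) + v 2 * (y 0 * iteratedDeriv 1 η (y 2))) := by
  have h : HasFDerivAt (UE n η 0) (n • sepD (linX η) 0 0 0 y) y :=
    (hasFDerivAt_sep (contDiff_linX hη) 0 0 0 y).const_smul n
  rw [h.fderiv, smul_apply, sepD_apply, smul_eq_mul, sep_linX, sep_linX, sep_linX,
    iteratedDeriv_id_zero, iteratedDeriv_id_one]
  simp

/-- `D E₁ (y) v = −n (v₁ η(y₂) + v₂ y₁ η'(y₂))`. [folklore] -/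
theorem fderiv_UE_one (hη : ContDiff ℝ ∞ η) (y v : E3) :
    fderiv ℝ (UE n η 1) y v =
      -(n * (v 1 * iteratedDeriv 0 η (y 2) + v 2 * (y 1 * iteratedDeriv 1 η (y 2)))) := by
  have h : HasFDerivAt (UE n η 1) (-(n • sepD (linY η) 0 0 0 y)) y :=
    ((hasFDerivAt_sep (contDiff_linY hη) 0 0 0 y).const_smul n).neg
  rw [h.fderiv, neg_apply, smul_apply, sepD_apply,
    smul_eq_mul, sep_linY, sep_linY, sep_linY, iteratedDeriv_id_zero, iteratedDeriv_id_one]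
  simp

/-- `D E₂ = 0`. [folklore] -/
theorem fderiv_UE_two (y v : E3) : fderiv ℝ (UE n η 2) y v = 0 := by
  rw [UE_two, (hasFDerivAt_const (0 : ℝ) y).fderiv]
  simp

/-- `Δ (y ↦ y₀ η(y₂)) = y ↦ y₀ η''(y₂)`. [folklore] -/
theorem laplacian_sep_linX (hη : ContDiff ℝ ∞ η) (k : ℕ) :
    Δ (sep (linX η) 0 0 k) = sep (linX η) 0 0 (k + 2) := by
  funext y
  rw [laplacian_sep (contDiff_linX hη)]
  norm_num [sep_linX, iteratedDeriv_id_add_two, iteratedDeriv_id_zero]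

/-- `Δ (y ↦ y₁ η(y₂)) = y ↦ y₁ η''(y₂)`. [folklore] -/
theorem laplacian_sep_linY (hη : ContDiff ℝ ∞ η) (k : ℕ) :
    Δ (sep (linY η) 0 0 k) = sep (linY η) 0 0 (k + 2) := by
  funext y
  rw [laplacian_sep (contDiff_linY hη)]
  norm_num [sep_linY, iteratedDeriv_id_add_two, iteratedDeriv_id_zero]

/-- `Δ E₀ = n · (y ↦ y₀ η''(y₂))`. [folklore] -/
theorem laplacian_UE_zero (hη : ContDiff ℝ ∞ η) :
    Δ (UE n η 0) = fun y => n * sep (linX η) 0 0 2 y := by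
  funext y
  have e : UE n η 0 = n • sep (linX η) 0 0 0 := by funext z; simp [smul_eq_mul]
  rw [e, InnerProductSpace.laplacian_smul n
    (((contDiff_sep (contDiff_linX hη) 0 0 0).of_le two_le_infty₃).contDiffAt),
    laplacian_sep_linX hη, smul_eq_mul]

/-- `Δ E₁ = −n · (y ↦ y₁ η''(y₂))`. [folklore] -/
theorem laplacian_UE_one (hη : ContDiff ℝ ∞ η) :
    Δ (UE n η 1) = fun y => -(n * sep (linY η) 0 0 2 y) := by
  funext y
  have e : UE n η 1 = -(n • sep (linY η) 0 0 0) := by funext z; simp [smul_eq_mul]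
  rw [e, InnerProductSpace.laplacian_neg, Pi.neg_apply, InnerProductSpace.laplacian_smul n
    (((contDiff_sep (contDiff_linY hη) 0 0 0).of_le two_le_infty₃).contDiffAt),
    laplacian_sep_linY hη, smul_eq_mul]

/-- `Δ² E₀ (y) = n y₀ η⁽⁴⁾(y₂)`. [folklore] -/
theorem laplacian2_UE_zero (hη : ContDiff ℝ ∞ η) (y : E3) :
    Δ (Δ (UE n η 0)) y = n * (y 0 * iteratedDeriv 4 η (y 2)) := by
  rw [laplacian_UE_zero hη]
  have e : (fun y => n * sep (linX η) 0 0 2 y) = n • sep (linX η) 0 0 2 := by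
    funext z; simp [smul_eq_mul]
  rw [e, InnerProductSpace.laplacian_smul n
    (((contDiff_sep (contDiff_linX hη) 0 0 2).of_le two_le_infty₃).contDiffAt),
    laplacian_sep_linX hη, smul_eq_mul, sep_linX, iteratedDeriv_id_zero]
  simp

/-- `Δ² E₁ (y) = −n y₁ η⁽⁴⁾(y₂)`. [folklore] -/
theorem laplacian2_UE_one (hη : ContDiff ℝ ∞ η) (y : E3) :
    Δ (Δ (UE n η 1)) y = -(n * (y 1 * iteratedDeriv 4 η (y 2))) := by
  rw [laplacian_UE_one hη]
  have e : (fun y => -(n * sep (linY η) 0 0 2 y)) = -(n • sep (linY η) 0 0 2) := by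
    funext z; simp [smul_eq_mul]
  rw [e, InnerProductSpace.laplacian_neg, Pi.neg_apply, InnerProductSpace.laplacian_smul n
    (((contDiff_sep (contDiff_linY hη) 0 0 2).of_le two_le_infty₃).contDiffAt),
    laplacian_sep_linY hη, smul_eq_mul, sep_linY, iteratedDeriv_id_zero]
  simp

/-- `Δ² E₂ = 0`. [folklore] -/
theorem laplacian2_UE_two (y : E3) : Δ (Δ (UE n η 2)) y = 0 := by
  rw [UE_two, InnerProductSpace.laplacian_const, Pi.zero_def, InnerProductSpace.laplacian_const]; rfl

/-- The components `Δ Eᵢ` are smooth. [folklore] -/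
theorem contDiff_laplacian_UE (hη : ContDiff ℝ ∞ η) (i : Fin 3) :
    ContDiff ℝ ∞ (Δ (UE n η i)) := by
  obtain rfl | rfl | rfl : i = 0 ∨ i = 1 ∨ i = 2 := by fin_cases i <;> simp
  · rw [laplacian_UE_zero hη]
    exact contDiff_const.mul (contDiff_sep (contDiff_linX hη) 0 0 2)
  · rw [laplacian_UE_one hη]
    exact (contDiff_const.mul (contDiff_sep (contDiff_linY hη) 0 0 2)).neg
  · rw [UE_two, InnerProductSpace.laplacian_const]; exact contDiff_const

/-- `Δ² E` componentwise. [folklore] -/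
theorem laplacian2_strain_apply (hη : ContDiff ℝ ∞ η) (y : E3) (i : Fin 3) :
    Δ (Δ (strain n η)) y i = Δ (Δ (UE n η i)) y := by
  have h1 : Δ (strain n η) = vec3 (fun i => Δ (UE n η i)) := by
    funext z; ext j
    rw [strain, laplacian_vec3_apply (fun j => (contDiff_UE hη j).of_le two_le_infty₃), vec3_apply]
  rw [h1, laplacian_vec3_apply (fun j => (contDiff_laplacian_UE hη j).of_le two_le_infty₃)]

/-- The strain is divergence free. [folklore] -/
theorem strain_trace (hη : ContDiff ℝ ∞ η) (y : E3) :
    LinearMap.trace ℝ E3 (fderiv ℝ (strain n η) y : E3 →ₗ[ℝ] E3) = 0 := by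
  rw [strain, trace_fderiv_vec3 (differentiable_UE hη), fderiv_UE_zero hη, fderiv_UE_one hη,
    fderiv_UE_two]
  simp only [PiLp.single_apply]
  simp

end Strain

end Sep3

end Summit.NavierStokesRegularity.FunctionalMining
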